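import Literature.Topology.FourManifolds.CappellShanesonStandardMatrix
import Mathlib.LinearAlgebra.Matrix.Charpoly.Minpoly
import HarnessLib

/-!
# Kim–Yamada's Theorem A at the matrix level: the trace `n ↔ 5 - n` symmetry of
# Cappell–Shaneson matrices and of Gompf's conjecture

Sibling of `CappellShanesonGompfEquivalence.lean` / `CappellShanesonStandardMatrix.lean`, serving
the named fact
`Literature.Topology.FourManifolds.kimYamada2023_nonempty_diffeomorph_sphere_four_of_trace_mem_Icc`
(`CappellShaneson.lean`; M. H. Kim, S. Yamada, *Ideal classes and Cappell–Shaneson homotopy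
4-spheres*, Kyungpook Math. J. 63 (2023) 373–411 = arXiv:1707.03860, Cor. C). That fact is reduced in
`CappellShanesonGompfEquivalence.lean` (`kimYamada2023_nonempty_diffeomorph_sphere_four_of_trace_mem_Icc_of`)
to Gompf's three topological leaves and to **Theorem B in matrix form**,
`∀ n ∈ [-64, 69], GompfConjectureForTrace n`. Kim–Yamada prove Theorem B only for the traces
`3 ≤ n ≤ 69` (§6.1: "By Theorem A, it suffices to check that Conjecture 2 is true for trace `n`
where `3 ≤ n ≤ 69`") and transfer it to `5 - n` by

* **Theorem A** (§1.2, proved in §3): "Conjecture 2 [Gompf: every Cappell–Shaneson matrix of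
  trace `n` is Gompf equivalent to `A₀`] is true for trace `n` if and only if Conjecture 2 is true
  for trace `5 - n` for any integer `n`."

This file PROVES Theorem A outright, in the tree's matrix-level rendering
(`gompfConjectureForTrace_iff_five_sub : GompfConjectureForTrace n ↔ GompfConjectureForTrace (5 - n)`),
and records the consequences: Theorem B on `[3, 69]` implies Theorem B on `[-64, 69]`
(`forall_gompfConjectureForTrace_of_Icc_three`) and hence the named fact, given the leaves
(`kimYamada2023_nonempty_diffeomorph_sphere_four_of_trace_mem_Icc_of_Icc_three`); Gompf's
conjecture for trace `10` from the two-class fact at trace `-5` (Example 3.4); and the matrix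
induction Lemma 6.1 in matrix form (`gompfConjectureForTrace_of_representatives`).

## The printed proof (§3) and its matrix-level rendering here

KY §3: **Thm. 3.1** — `φₙ : ℤ[Θₙ] → ℤ[Θ_{5-n}]`, `φₙ(Θₙ) = Θ²_{5-n} + (n - 4) Θ_{5-n} + 1`, is a ring
isomorphism with inverse `φ_{5-n}`, where `Θₙ` is a root of `fₙ(x) = x³ - n x² + (n - 1) x - 1`
(proof: `f_{5-n}(αₙ) = 0` for `αₙ = pₙ(Θₙ)`, `pₙ(x) = x² + (1 - n) x + 1`, and
`p_{5-n}(pₙ(Θₙ)) = Θₙ`); **Cor. 3.2** — the induced monoid isomorphism `ψₙ` of ideal class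
monoids sends `[⟨Θₙ - c, d⟩]` to `[⟨Θ_{5-n} - pₙ(c), d⟩]` (Claim: `⟨Θₙ - c, d⟩ = ⟨pₙ(Θₙ) - pₙ(c), d⟩`);
**Thm. 3.3** — via the Latimer–MacDuffee–Taussky correspondence (Prop. 2.14) this is the bijection
`X_{c,d,n} ↦ X*_{c,d,n} = X_{pₙ(c),d,5-n}` on similarity classes of Cappell–Shaneson matrices;
**Lemma 3.5** — `A ∼ B` Gompf equivalent ⟹ `A* ∼ B*` (case `∼_S` by Thm. 3.3; case `∼_G`:
`X*_{c,d,n+kd} = X_{p_{n+kd}(c),d,5-n-kd}` and `p_{n+kd}(c) ≡ pₙ(c) (mod d)`, with Remark 2.15);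
**Lemma 3.6** — `(A*)* ∼ A` (`p_{5-n}(pₙ(c)) = c + fₙ(c)(c - n + 2)`); **proof of Thm. A** — for `X`
of trace `5 - n`, `X*` has trace `n`, so `X* ∼ A₀`, hence `X ∼ (X*)* ∼ A₀* ∼ A₁ ∼ A₀` (Example 3.4:
`A₀* ∼ A₁`; Remark 2.22).

Rendering WITHOUT ideal classes (the general Latimer–MacDuffee–Taussky correspondence is not in
the tree; D-0026: no new facts). Pulling a `ℤ[Θ_{5-n}]`-module back along `φ_{5-n}` lets
`Θ_{5-n}` act as `pₙ(Θₙ)`, so on matrices the symmetry is the **polynomial involution**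
`A ↦ A* := pₙ(A) = A² + (1 - n) A + 1`, `n = tr A` (`csDualMatrix`, `csDual`):

* for a Cappell–Shaneson matrix `A` (`A ∈ SL(3, ℤ)`, `det (A - 1) = 1`, i.e. `χ_A = f_{tr A}`,
  `charpoly_eq_csPoly`) of trace `n`, `f_{5-n}(A*) = fₙ(A) qₙ(A) = 0` for the explicit cubic
  `qₙ = kyQuot n` (`csPoly_five_sub_comp_kyPoly`, the identity `f_{5-n} ∘ pₙ = fₙ · qₙ` behind
  Thm. 3.1), so `χ_{A*} = f_{5-n}` by irreducibility (minimal polynomial over `ℚ`;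
  `charpoly_csDualMatrix`): `A*` is a Cappell–Shaneson matrix of trace `5 - n`;
* `(A*)* = A` (`csDual_csDual`; Lemma 3.6's identity `p_{5-n} ∘ pₙ = X + fₙ · (X - n + 2)`,
  `kyPoly_five_sub_comp_kyPoly`, and Cayley–Hamilton);
* `(P A P⁻¹)* = P A* P⁻¹` (`csDual_conj`; the case `∼_S` of Lemma 3.5 needs no number theory);
* for the standard matrix `X = X_{c,d,n} = !![0, a, b; 0, c, d; 1, 0, n - c]`
  (`standardCSMatrix c d n h` of `CappellShanesonStandardMatrix.lean`, `d ∣ fₙ(c)`, `a d = -fₙ(c)`,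
  `b = (c - 1)(n - c - 1)`, Remark 2.8) the matrix `X*` is CONJUGATE to `X_{pₙ(c),d,5-n}` by the
  explicit unimodular `U = !![-1, a (c - n + 2), 0; 0, 1, 0; 1, 0, 1]`
  (`isConj_csDual_standardCSMatrix`) — the change of basis between the two Latimer–MacDuffee eigenvector
  bases `((Θ-n+c)(Θ-c), d, Θ-c)` and `((α-5+n+c*)(α-c*), d, α-c*)` of the one lattice
  `⟨Θₙ - c, d⟩ = ⟨α - c*, d⟩` of Cor. 3.2's Claim, which is Thm. 3.3 made explicit;
* Remark 2.15 (`X_{c,d,n} ∼ X_{c+jd,d,n}`) and Remark 2.9 for an arbitrary matrix in Gompf's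
  standard form (`A ∼ X_{c,d,n}`) likewise by explicit conjugators (`isConj_standardCSMatrix_cShift`,
  `IsGompfStandardForm.isConj_standardCSMatrix`; the trace move `X_{c,d,n} ∼_G X_{c,d,n+kd}` is
  the sibling's `gompfEquiv_standardCSMatrix_add_mul`), giving Lemma 3.5 (`gompfEquiv_csDual`)
  and Thm. A.

## References

* [KimYamada2023] M. H. Kim, S. Yamada, Kyungpook Math. J. 63 (2023) 373–411 (arXiv:1707.03860;
  locators as in the arXiv text): §1.2 (Thm. A, Thm. B), §2.1 (Remarks 2.8, 2.9, Prop. 2.10),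
  §2.3 (Prop. 2.14, Remark 2.15), §2.4 (Def. 2.18, Remark 2.22), §3 (Thm. 3.1, Cor. 3.2, Thm. 3.3,
  Example 3.4, Lemmas 3.5, 3.6, proof of Thm. A), §6.1 (Lemma 6.1, proof of Thm. B).
* [GompfAGT2010] R. E. Gompf, Algebr. Geom. Topol. 10 (2010) 1665–1681, §3.
-/

noncomputable section

open Set Polynomial
open scoped MatrixGroups

namespace Literature.Topology.FourManifolds

universe u

/-! ### The polynomials `pₙ`, `qₙ` and the identities behind Theorem 3.1 and Lemma 3.6 -/

section Polynomials

/-- **Kim–Yamada's polynomial `pₙ(x) = x² + (1 - n) x + 1`** (KY Cor. 3.2, Thm. 3.3: `c* = pₙ(c)`;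
Thm. 3.1: `φ_{5-n}(Θ_{5-n}) = pₙ(Θₙ) = Θₙ² + (1 - n) Θₙ + 1`). [cite: KimYamada2023, Thm. 3.1 and Cor. 3.2] -/
def kyPoly (n : ℤ) : ℤ[X] := X ^ 2 + C (1 - n) * X + 1

/-- The cubic cofactor `qₙ(x) = x³ + (3 - 2n) x² + (n² - 3n + 2) x + 1` with
`f_{5-n}(pₙ(x)) = fₙ(x) qₙ(x)` (implicit in the proof of KY Thm. 3.1, where `f_{5-n}(pₙ(Θₙ)) = 0`
is checked). [cite: KimYamada2023, Thm. 3.1 (proof)] -/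
def kyQuot (n : ℤ) : ℤ[X] := X ^ 3 + C (3 - 2 * n) * X ^ 2 + C (n ^ 2 - 3 * n + 2) * X + 1

/-- **`f_{5-n} ∘ pₙ = fₙ · qₙ`**: the polynomial identity which makes `pₙ(Θₙ)` a root of `f_{5-n}`
(KY Thm. 3.1, proof: "the following shows that `f_{5-n}(αₙ) = 0`"). [cite: KimYamada2023, Thm. 3.1 (proof)] -/
theorem csPoly_five_sub_comp_kyPoly (n : ℤ) :
    (csPoly (5 - n)).comp (kyPoly n) = csPoly n * kyQuot n := by
  simp only [csPoly, kyPoly, kyQuot, sub_comp, add_comp, mul_comp, pow_comp, X_comp, C_comp,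
    one_comp]
  simp only [map_sub, map_add, map_mul, map_pow, map_one, map_ofNat]
  ring

/-- **`p_{5-n} ∘ pₙ = x + fₙ(x) (x - n + 2)`**: the identity of the proof of KY Lemma 3.6
("`p_{5-n}(pₙ(c)) = c + fₙ(c)(c - n + 2)`"), which makes `A ↦ A*` an involution on
Cappell–Shaneson matrices. [cite: KimYamada2023, Lemma 3.6 (proof)] -/
theorem kyPoly_five_sub_comp_kyPoly (n : ℤ) :
    (kyPoly (5 - n)).comp (kyPoly n) = X + csPoly n * (X - C n + 2) := by
  simp only [csPoly, kyPoly, add_comp, mul_comp, pow_comp, X_comp, C_comp, one_comp]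
  simp only [map_sub, map_one, map_ofNat]
  ring

/-- The value `pₙ(c) = c² + (1 - n) c + 1`. [cite: KimYamada2023, Cor. 3.2] -/
theorem eval_kyPoly (n c : ℤ) : (kyPoly n).eval c = c ^ 2 + (1 - n) * c + 1 := by
  simp [kyPoly]

/-- The value `qₙ(c)`. [cite: KimYamada2023, Thm. 3.1 (proof)] -/
theorem eval_kyQuot (n c : ℤ) :
    (kyQuot n).eval c = c ^ 3 + (3 - 2 * n) * c ^ 2 + (n ^ 2 - 3 * n + 2) * c + 1 := by
  simp [kyQuot]

end Polynomials

/-! ### Reading a Cappell–Shaneson matrix off its characteristic polynomial -/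

section Charpoly

/-- A `3 × 3` integer matrix annihilated by some `f_m` has characteristic polynomial `f_m`: over `ℚ`
the minimal polynomial divides the irreducible cubic `f_m` (`irreducible_csPolyQ`), hence equals
it, and divides the cubic characteristic polynomial. (The converse of the tree's
`aeval_csPoly_eq_zero`.) [cite: AitchisonRubinstein1984, Appendix, Lemma A4] -/
theorem charpoly_eq_csPoly_of_aeval_eq_zero {M : Matrix (Fin 3) (Fin 3) ℤ} {m : ℤ}
    (hM : aeval M (csPoly m) = 0) : M.charpoly = csPoly m := by
  have h1 : aeval (M.map (algebraMap ℤ ℚ)) (csPolyQ m) = 0 := by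
    have e1 : aeval (M.map (algebraMap ℤ ℚ)) (csPolyQ m) =
        (csPoly m).eval₂ ((algebraMap ℚ (Matrix (Fin 3) (Fin 3) ℚ)).comp (algebraMap ℤ ℚ))
          (M.map (algebraMap ℤ ℚ)) := by
      rw [aeval_def, csPolyQ, eval₂_map]
    have e2 : (algebraMap ℤ ℚ).mapMatrix (aeval M (csPoly m)) =
        (csPoly m).eval₂ ((algebraMap ℤ ℚ).mapMatrix.comp (algebraMap ℤ (Matrix (Fin 3) (Fin 3) ℤ)))
          ((algebraMap ℤ ℚ).mapMatrix M) := by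
      rw [aeval_def, hom_eval₂]
    rw [e1, RingHom.ext_int ((algebraMap ℚ (Matrix (Fin 3) (Fin 3) ℚ)).comp (algebraMap ℤ ℚ))
      ((algebraMap ℤ ℚ).mapMatrix.comp (algebraMap ℤ (Matrix (Fin 3) (Fin 3) ℤ))),
      show M.map (algebraMap ℤ ℚ) = (algebraMap ℤ ℚ).mapMatrix M from rfl, ← e2, hM, map_zero]
  have hmin : csPolyQ m = minpoly ℚ (M.map (algebraMap ℤ ℚ)) :=
    minpoly.eq_of_irreducible_of_monic (irreducible_csPolyQ m) h1 (monic_csPolyQ m)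
  have hchar : (M.map (algebraMap ℤ ℚ)).charpoly = csPolyQ m := by
    refine eq_of_monic_of_dvd_of_natDegree_le (monic_csPolyQ m) (Matrix.charpoly_monic _) ?_ ?_
    · rw [hmin]
      exact Matrix.minpoly_dvd_charpoly _
    · rw [Matrix.charpoly_natDegree_eq_dim, Fintype.card_fin, natDegree_csPolyQ]
  apply Polynomial.map_injective (algebraMap ℤ ℚ) (algebraMap ℤ ℚ).injective_int
  rw [← Matrix.charpoly_map, hchar, csPolyQ]

/-- A `3 × 3` integer matrix with characteristic polynomial `f_m` has determinant `1`
(`f_m(0) = -1`). [cite: AitchisonRubinstein1984, Appendix, Theorem A3] -/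
theorem det_eq_one_of_charpoly_eq_csPoly {M : Matrix (Fin 3) (Fin 3) ℤ} {m : ℤ}
    (h : M.charpoly = csPoly m) : M.det = 1 := by
  have hd := Matrix.det_eq_sign_charpoly_coeff M
  rw [h, coeff_csPoly, Fintype.card_fin] at hd
  simpa using hd

/-- A `3 × 3` integer matrix with characteristic polynomial `f_m` has trace `m`. [cite: AitchisonRubinstein1984, Appendix, Theorem A3] -/
theorem trace_eq_of_charpoly_eq_csPoly {M : Matrix (Fin 3) (Fin 3) ℤ} {m : ℤ}
    (h : M.charpoly = csPoly m) : M.trace = m := by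
  have ht := Matrix.trace_eq_neg_charpoly_coeff M
  rw [h, coeff_csPoly, Fintype.card_fin] at ht
  simpa using ht

/-- A `3 × 3` integer matrix with characteristic polynomial `f_m` satisfies `det (M - 1) = 1`
(`f_m(1) = -1 = det (1 - M)`): it is a Cappell–Shaneson matrix. [cite: AitchisonRubinstein1984, Appendix, Theorem A3] -/
theorem det_sub_one_eq_one_of_charpoly_eq_csPoly {M : Matrix (Fin 3) (Fin 3) ℤ} {m : ℤ}
    (h : M.charpoly = csPoly m) : (M - 1).det = 1 := by
  have he := Matrix.eval_charpoly M 1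
  have hsc : Matrix.scalar (Fin 3) (1 : ℤ) - M = -(M - 1) := by
    rw [neg_sub]
    rfl
  rw [h, eval_csPoly, hsc, Matrix.det_neg, Fintype.card_fin] at he
  linear_combination he

end Charpoly

/-! ### The dual `A* = A² + (1 - tr A) A + 1` of a Cappell–Shaneson matrix -/

section Dual

/-- **The dual matrix** `M* = M² + (1 - tr M) M + 1 = p_{tr M}(M)` (Kim–Yamada's symmetry
`X ↦ X*` of Thm. 3.3 realised as the polynomial `pₙ` of Thm. 3.1/Cor. 3.2 evaluated at the matrix:
the `ℤ[Θ_{5-n}]`-module of `M*` is the `ℤ[Θₙ]`-module of `M` pulled back along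
`φ_{5-n} : Θ_{5-n} ↦ pₙ(Θₙ)`). [cite: KimYamada2023, Thm. 3.1 and Thm. 3.3] -/
def csDualMatrix (M : Matrix (Fin 3) (Fin 3) ℤ) : Matrix (Fin 3) (Fin 3) ℤ :=
  M * M + (1 - M.trace) • M + 1

/-- `M* = p_{tr M}(M)`. [cite: KimYamada2023, Thm. 3.1 and Thm. 3.3] -/
theorem csDualMatrix_eq_aeval (M : Matrix (Fin 3) (Fin 3) ℤ) :
    csDualMatrix M = aeval M (kyPoly M.trace) := by
  rw [csDualMatrix, kyPoly, map_add, map_add, map_mul, aeval_C, map_pow, aeval_X, map_one,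
    Algebra.algebraMap_eq_smul_one, smul_one_mul, sq]

/-- Conjugation invariance of the dual: `(P M P')* = P M* P'` whenever `P' P = 1 = P P'`. [cite: KimYamada2023, Lemma 3.5] -/
theorem csDualMatrix_conj (P P' M : Matrix (Fin 3) (Fin 3) ℤ) (h₁ : P' * P = 1) (h₂ : P * P' = 1) :
    csDualMatrix (P * M * P') = P * csDualMatrix M * P' := by
  have htr : (P * M * P').trace = M.trace := by
    rw [Matrix.trace_mul_cycle, h₁, Matrix.one_mul]
  have hsq : P * M * P' * (P * M * P') = P * (M * M) * P' := by
    calc P * M * P' * (P * M * P') = P * M * (P' * P) * M * P' := by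
          simp only [Matrix.mul_assoc]
      _ = P * (M * M) * P' := by rw [h₁, Matrix.mul_one]; simp only [Matrix.mul_assoc]
  rw [csDualMatrix, csDualMatrix, htr, hsq, Matrix.mul_add, Matrix.mul_add, Matrix.add_mul,
    Matrix.add_mul, Matrix.mul_one, h₂, Matrix.mul_smul, Matrix.smul_mul]

variable {A : SL(3, ℤ)}

/-- **The dual of a Cappell–Shaneson matrix of trace `n` has characteristic polynomial `f_{5-n}`**:
`f_{5-n}(A*) = f_n(A) q_n(A) = 0` (`csPoly_five_sub_comp_kyPoly`, Cayley–Hamilton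
`aeval_csPoly_eq_zero`) and `f_{5-n}` is irreducible (KY Thm. 3.1: `f_{5-n}(pₙ(Θₙ)) = 0`; Thm. 3.3:
`X*` has trace `5 - n`). [cite: KimYamada2023, Thm. 3.1 and Thm. 3.3] -/
theorem charpoly_csDualMatrix (hA : ((A : Matrix (Fin 3) (Fin 3) ℤ) - 1).det = 1) :
    (csDualMatrix (A : Matrix (Fin 3) (Fin 3) ℤ)).charpoly =
      csPoly (5 - Matrix.trace (A : Matrix (Fin 3) (Fin 3) ℤ)) := by
  apply charpoly_eq_csPoly_of_aeval_eq_zero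
  rw [csDualMatrix_eq_aeval, ← aeval_comp, csPoly_five_sub_comp_kyPoly, map_mul,
    aeval_csPoly_eq_zero A hA, zero_mul]

/-- The dual of a Cappell–Shaneson matrix has determinant `1`. [cite: KimYamada2023, Thm. 3.3] -/
theorem det_csDualMatrix (hA : ((A : Matrix (Fin 3) (Fin 3) ℤ) - 1).det = 1) :
    (csDualMatrix (A : Matrix (Fin 3) (Fin 3) ℤ)).det = 1 :=
  det_eq_one_of_charpoly_eq_csPoly (charpoly_csDualMatrix hA)

/-- **The dual Cappell–Shaneson matrix `A* ∈ SL(3, ℤ)`** of `A ∈ SL(3, ℤ)`: the matrix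
`A² + (1 - tr A) A + 1` when this has determinant `1` — always the case for a Cappell–Shaneson
matrix (`det (A - 1) = 1`, `det_csDualMatrix`) — and `A` itself otherwise (a harmless convention
which keeps `csDual` total and conjugation-equivariant). On similarity classes of Cappell–Shaneson
matrices this is Kim–Yamada's bijection `A ↦ A*` between trace `n` and trace `5 - n` (Thm. 3.3),
rendered without ideal classes. [cite: KimYamada2023, Thm. 3.3] -/
def csDual (A : SL(3, ℤ)) : SL(3, ℤ) :=
  if h : (csDualMatrix (A : Matrix (Fin 3) (Fin 3) ℤ)).det = 1 then
    ⟨csDualMatrix (A : Matrix (Fin 3) (Fin 3) ℤ), h⟩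
  else A

/-- For a Cappell–Shaneson matrix, `↑(A*) = A² + (1 - tr A) A + 1`. [cite: KimYamada2023, Thm. 3.3] -/
theorem coe_csDual (hA : ((A : Matrix (Fin 3) (Fin 3) ℤ) - 1).det = 1) :
    ((csDual A : SL(3, ℤ)) : Matrix (Fin 3) (Fin 3) ℤ) = csDualMatrix (A : Matrix (Fin 3) (Fin 3) ℤ) := by
  rw [csDual, dif_pos (det_csDualMatrix hA)]

/-- **`A*` is a Cappell–Shaneson matrix**: `det (A* - 1) = 1`. [cite: KimYamada2023, Thm. 3.3] -/
theorem det_coe_csDual_sub_one (hA : ((A : Matrix (Fin 3) (Fin 3) ℤ) - 1).det = 1) :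
    (((csDual A : SL(3, ℤ)) : Matrix (Fin 3) (Fin 3) ℤ) - 1).det = 1 := by
  rw [coe_csDual hA]
  exact det_sub_one_eq_one_of_charpoly_eq_csPoly (charpoly_csDualMatrix hA)

/-- **`tr A* = 5 - tr A`** (KY Thm. 3.3: `A*` has trace `5 - n`). [cite: KimYamada2023, Thm. 3.3] -/
theorem trace_coe_csDual (hA : ((A : Matrix (Fin 3) (Fin 3) ℤ) - 1).det = 1) :
    Matrix.trace ((csDual A : SL(3, ℤ)) : Matrix (Fin 3) (Fin 3) ℤ) =
      5 - Matrix.trace (A : Matrix (Fin 3) (Fin 3) ℤ) := by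
  rw [coe_csDual hA]
  exact trace_eq_of_charpoly_eq_csPoly (charpoly_csDualMatrix hA)

/-- **The dual is an involution on Cappell–Shaneson matrices: `(A*)* = A`** (KY Lemma 3.6, "`A` is
similar to `(A*)*`" — at the matrix level it is an equality: `p_{5-n}(pₙ(A)) = A + fₙ(A)(A - n + 2)
= A` by `kyPoly_five_sub_comp_kyPoly` and Cayley–Hamilton). [cite: KimYamada2023, Lemma 3.6] -/
theorem csDual_csDual (hA : ((A : Matrix (Fin 3) (Fin 3) ℤ) - 1).det = 1) :
    csDual (csDual A) = A := by
  refine Subtype.ext ?_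
  rw [coe_csDual (det_coe_csDual_sub_one hA), csDualMatrix_eq_aeval, trace_coe_csDual hA,
    coe_csDual hA, csDualMatrix_eq_aeval, ← aeval_comp, kyPoly_five_sub_comp_kyPoly, map_add,
    aeval_X, map_mul, aeval_csPoly_eq_zero A hA, zero_mul, add_zero]

/-- **Conjugation equivariance: `(P A P⁻¹)* = P A* P⁻¹`** (so `∼_S` is respected, the similarity
case of KY Lemma 3.5 — here without the Latimer–MacDuffee–Taussky correspondence). [cite: KimYamada2023, Lemma 3.5] -/
theorem csDual_conj (A P : SL(3, ℤ)) : csDual (P * A * P⁻¹) = P * csDual A * P⁻¹ := by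
  have h₁ : ((P⁻¹ : SL(3, ℤ)) : Matrix (Fin 3) (Fin 3) ℤ) * (P : Matrix (Fin 3) (Fin 3) ℤ) = 1 := by
    rw [← Matrix.SpecialLinearGroup.coe_mul, inv_mul_cancel, Matrix.SpecialLinearGroup.coe_one]
  have h₂ : (P : Matrix (Fin 3) (Fin 3) ℤ) * ((P⁻¹ : SL(3, ℤ)) : Matrix (Fin 3) (Fin 3) ℤ) = 1 := by
    rw [← Matrix.SpecialLinearGroup.coe_mul, mul_inv_cancel, Matrix.SpecialLinearGroup.coe_one]
  have hmat : csDualMatrix ((P * A * P⁻¹ : SL(3, ℤ)) : Matrix (Fin 3) (Fin 3) ℤ) =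
      (P : Matrix (Fin 3) (Fin 3) ℤ) * csDualMatrix (A : Matrix (Fin 3) (Fin 3) ℤ) *
        ((P⁻¹ : SL(3, ℤ)) : Matrix (Fin 3) (Fin 3) ℤ) := by
    rw [Matrix.SpecialLinearGroup.coe_mul, Matrix.SpecialLinearGroup.coe_mul]
    exact csDualMatrix_conj _ _ _ h₁ h₂
  have hdet : (csDualMatrix ((P * A * P⁻¹ : SL(3, ℤ)) : Matrix (Fin 3) (Fin 3) ℤ)).det =
      (csDualMatrix (A : Matrix (Fin 3) (Fin 3) ℤ)).det := by
    rw [hmat, Matrix.det_mul, Matrix.det_mul, Matrix.SpecialLinearGroup.det_coe,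
      Matrix.SpecialLinearGroup.det_coe, one_mul, mul_one]
  by_cases h : (csDualMatrix (A : Matrix (Fin 3) (Fin 3) ℤ)).det = 1
  · refine Subtype.ext ?_
    unfold csDual
    rw [dif_pos (hdet.trans h), dif_pos h]
    exact hmat
  · unfold csDual
    rw [dif_neg (fun h' => h (hdet.symm.trans h')), dif_neg h]

/-- The dual respects conjugacy. [cite: KimYamada2023, Lemma 3.5] -/
theorem isConj_csDual {A B : SL(3, ℤ)} (h : IsConj A B) : IsConj (csDual A) (csDual B) := by
  obtain ⟨P, rfl⟩ := (isConj_iff_exists_eq_conj A B).1 h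
  rw [csDual_conj]
  exact (isConj_iff_exists_eq_conj _ _).2 ⟨P, rfl⟩

end Dual

/-! ### Explicit conjugations of the standard matrices `X_{c,d,n}` -/

section Standard

variable {c d n : ℤ}

/-- `X_{c,d,n}` only depends on the triple `(c, d, n)` (proof irrelevance; both `c` and `n` may be
rewritten). [folklore] -/
theorem standardCSMatrix_ext {c' n' : ℤ} (h : d ∣ (csPoly n).eval c) (h' : d ∣ (csPoly n').eval c')
    (hc : c = c') (hn : n = n') : standardCSMatrix c d n h = standardCSMatrix c' d n' h' := by
  subst hc hn
  rfl

/-! #### Remark 2.9: a matrix in Gompf's standard form is conjugate to `X_{c,d,tr A}` -/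

/-- For a Cappell–Shaneson matrix `A = !![0, a, b; 0, c, d; 1, e, f]` in Gompf's standard form,
`f_{tr A}(c) = -d (a + c e)`: the divisibility `d ∣ f_{c+f}(c)` behind KY Remark 2.9 / Prop. 2.10
(`a d - b c = 1` and `b = (c - 1)(f - 1) - d e`, Gompf's Lemma 3.3 computation). [cite: KimYamada2023, Remark 2.9 and Prop. 2.10] -/
theorem IsGompfStandardForm.eval_csPoly_trace {A : SL(3, ℤ)} (hA : IsGompfStandardForm A)
    (hdet : ((A : Matrix (Fin 3) (Fin 3) ℤ) - 1).det = 1) :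
    (csPoly (Matrix.trace (A : Matrix (Fin 3) (Fin 3) ℤ))).eval ((A : Matrix (Fin 3) (Fin 3) ℤ) 1 1) =
      -((A : Matrix (Fin 3) (Fin 3) ℤ) 1 2 *
        ((A : Matrix (Fin 3) (Fin 3) ℤ) 0 1 +
          (A : Matrix (Fin 3) (Fin 3) ℤ) 1 1 * (A : Matrix (Fin 3) (Fin 3) ℤ) 2 1)) := by
  have hdetA := A.2
  rw [hA.det_coe_eq] at hdetA
  have hb := hA.apply_zero_two_eq hdet
  obtain ⟨h0, -, -⟩ := hA
  rw [Matrix.trace_fin_three, h0, zero_add, eval_csPoly]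
  linear_combination hdetA + (A : Matrix (Fin 3) (Fin 3) ℤ) 1 1 * hb

/-- Hence `d ∣ f_{tr A}(c)` for `A` in Gompf's standard form with middle row `(0, c, d)`
("`fₙ(c) ≡ 0 mod d`", KY Prop. 2.10). [cite: KimYamada2023, Prop. 2.10] -/
theorem IsGompfStandardForm.dvd_eval_csPoly {A : SL(3, ℤ)} (hA : IsGompfStandardForm A)
    (hdet : ((A : Matrix (Fin 3) (Fin 3) ℤ) - 1).det = 1) :
    (A : Matrix (Fin 3) (Fin 3) ℤ) 1 2 ∣
      (csPoly (Matrix.trace (A : Matrix (Fin 3) (Fin 3) ℤ))).eval ((A : Matrix (Fin 3) (Fin 3) ℤ) 1 1) :=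
  ⟨-((A : Matrix (Fin 3) (Fin 3) ℤ) 0 1 +
      (A : Matrix (Fin 3) (Fin 3) ℤ) 1 1 * (A : Matrix (Fin 3) (Fin 3) ℤ) 2 1),
    by rw [hA.eval_csPoly_trace hdet]; ring⟩

/-- The entry `a` of `X_{c,d,tr A}` is `a + c e` (KY Remark 2.9, display: the `(0,1)` entry of
`E_e A E_e⁻¹`). [cite: KimYamada2023, Remark 2.9] -/
theorem IsGompfStandardForm.csEntryA_eq {A : SL(3, ℤ)} (hA : IsGompfStandardForm A)
    (hdet : ((A : Matrix (Fin 3) (Fin 3) ℤ) - 1).det = 1) :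
    csEntryA ((A : Matrix (Fin 3) (Fin 3) ℤ) 1 1) ((A : Matrix (Fin 3) (Fin 3) ℤ) 1 2)
        (Matrix.trace (A : Matrix (Fin 3) (Fin 3) ℤ)) =
      (A : Matrix (Fin 3) (Fin 3) ℤ) 0 1 +
        (A : Matrix (Fin 3) (Fin 3) ℤ) 1 1 * (A : Matrix (Fin 3) (Fin 3) ℤ) 2 1 := by
  apply mul_right_cancel₀ (hA.apply_one_two_ne_zero hdet)
  rw [csEntryA_mul (hA.dvd_eval_csPoly hdet), hA.eval_csPoly_trace hdet]
  ring

/-- **Remark 2.9 (every matrix in Gompf's standard form is conjugate to some `X_{c,d,n}`), proved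
with the explicit shear**: for `A = !![0, a, b; 0, c, d; 1, e, f] ∈ SL(3, ℤ)` with `det (A - 1) = 1`,
`E_e A E_e⁻¹ = X_{c,d,c+f}` (entry `a + c e`), where `E_e = !![1, e, 0; 0, 1, 0; 0, 0, 1] = gompfShear e`
(KY Remark 2.9's display; `b + d e = (c - 1)(f - 1)` is Gompf's Lemma 3.3 computation
`IsGompfStandardForm.apply_zero_two_eq`). [cite: KimYamada2023, Remark 2.9] -/
theorem IsGompfStandardForm.conj_gompfShear_eq_standardCSMatrix {A : SL(3, ℤ)}
    (hA : IsGompfStandardForm A) (hdet : ((A : Matrix (Fin 3) (Fin 3) ℤ) - 1).det = 1) :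
    gompfShear ((A : Matrix (Fin 3) (Fin 3) ℤ) 2 1) * A *
        (gompfShear ((A : Matrix (Fin 3) (Fin 3) ℤ) 2 1))⁻¹ =
      standardCSMatrix ((A : Matrix (Fin 3) (Fin 3) ℤ) 1 1) ((A : Matrix (Fin 3) (Fin 3) ℤ) 1 2)
        (Matrix.trace (A : Matrix (Fin 3) (Fin 3) ℤ)) (hA.dvd_eval_csPoly hdet) := by
  have ha := hA.csEntryA_eq hdet
  have hb := hA.apply_zero_two_eq hdet
  obtain ⟨h0, h1, h2⟩ := hA
  have htr : Matrix.trace (A : Matrix (Fin 3) (Fin 3) ℤ) =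
      (A : Matrix (Fin 3) (Fin 3) ℤ) 1 1 + (A : Matrix (Fin 3) (Fin 3) ℤ) 2 2 := by
    rw [Matrix.trace_fin_three, h0, zero_add]
  refine Subtype.ext ?_
  rw [Matrix.SpecialLinearGroup.coe_mul, Matrix.SpecialLinearGroup.coe_mul,
    Matrix.SpecialLinearGroup.transvection_inv, coe_gompfShear, coe_gompfShear,
    coe_standardCSMatrix, ha, htr]
  ext i j
  fin_cases i <;> fin_cases j <;> simp only [Matrix.mul_apply, Fin.sum_univ_three] <;>
    simp [h0, h1, h2] <;>
    first
      | linear_combination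
      | linear_combination hb

/-- **Remark 2.9 as a conjugacy statement**: a Cappell–Shaneson matrix in Gompf's standard form
with middle row `(0, c, d)` and trace `n` is conjugate in `SL(3, ℤ)` to the standard matrix
`X_{c,d,n}` (in particular `d ∣ fₙ(c)`). [cite: KimYamada2023, Remark 2.9] -/
theorem IsGompfStandardForm.isConj_standardCSMatrix {A : SL(3, ℤ)} (hA : IsGompfStandardForm A)
    (hdet : ((A : Matrix (Fin 3) (Fin 3) ℤ) - 1).det = 1) {c d n : ℤ}
    (hc : (A : Matrix (Fin 3) (Fin 3) ℤ) 1 1 = c) (hd : (A : Matrix (Fin 3) (Fin 3) ℤ) 1 2 = d)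
    (hn : Matrix.trace (A : Matrix (Fin 3) (Fin 3) ℤ) = n) :
    ∃ h : d ∣ (csPoly n).eval c, IsConj A (standardCSMatrix c d n h) := by
  subst hc hd hn
  exact ⟨hA.dvd_eval_csPoly hdet, (isConj_iff_exists_eq_conj _ _).2
    ⟨_, (hA.conj_gompfShear_eq_standardCSMatrix hdet).symm⟩⟩

/-! #### Remark 2.15: `X_{c,d,n} ∼ X_{c+jd,d,n}` -/

/-- `fₙ(c + jd) = fₙ(c) - d j (2nc + ndj - n - 3c² - 3cdj - d²j² + 1)`. [cite: KimYamada2023, Remark 2.15] -/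
theorem eval_csPoly_cShift (n j d c : ℤ) :
    (csPoly n).eval (c + j * d) = (csPoly n).eval c -
      d * (j * (2 * n * c + n * d * j - n - 3 * c ^ 2 - 3 * c * d * j - d ^ 2 * j ^ 2 + 1)) := by
  rw [eval_csPoly, eval_csPoly]
  ring

/-- `d ∣ fₙ(c) ⇒ d ∣ fₙ(c + jd)` (the triple `(c + jd, d, n)` is again in `𝒞𝒮`; KY Remark 2.15:
`⟨Θₙ - c, d⟩ = ⟨Θₙ - c - kd, d⟩`). [cite: KimYamada2023, Remark 2.15] -/
theorem dvd_eval_csPoly_cShift (h : d ∣ (csPoly n).eval c) (j : ℤ) :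
    d ∣ (csPoly n).eval (c + j * d) := by
  rw [eval_csPoly_cShift]
  exact dvd_sub h (dvd_mul_right d _)

/-- The entry `a` of `X_{c+jd,d,n}` is `a + j (2nc + ndj - n - 3c² - 3cdj - d²j² + 1)`. [cite: KimYamada2023, Remark 2.15] -/
theorem csEntryA_cShift (h : d ∣ (csPoly n).eval c) (j : ℤ) :
    csEntryA (c + j * d) d n = csEntryA c d n +
      j * (2 * n * c + n * d * j - n - 3 * c ^ 2 - 3 * c * d * j - d ^ 2 * j ^ 2 + 1) := by
  apply mul_right_cancel₀ (ne_zero_of_dvd_eval_csPoly h)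
  rw [csEntryA_mul (dvd_eval_csPoly_cShift h j), eval_csPoly_cShift, add_mul, csEntryA_mul h]
  ring

/-- **Remark 2.15 (`X_{c,d,n}` and `X_{c+jd,d,n}` are similar), proved with an explicit
conjugator**: `U₂ X_{c,d,n} = X_{c+jd,d,n} U₂` for `U₂ = !![1, j (n - 2c - jd), 0; 0, 1, 0; 0, -j, 1]`
(the change of basis between the Latimer–MacDuffee eigenvector bases of the one ideal
`⟨Θₙ - c, d⟩ = ⟨Θₙ - c - jd, d⟩`; KY derive the remark from Prop. 2.14). [cite: KimYamada2023, Remark 2.15] -/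
theorem isConj_standardCSMatrix_cShift (h : d ∣ (csPoly n).eval c) (j : ℤ) :
    IsConj (standardCSMatrix c d n h) (standardCSMatrix (c + j * d) d n (dvd_eval_csPoly_cShift h j)) := by
  refine (isConj_iff_exists_isUnit_det _ _).2
    ⟨!![1, j * (n - 2 * c - j * d), 0; 0, 1, 0; 0, -j, 1], ?_, ?_⟩
  · simp [Matrix.det_fin_three]
  · rw [coe_standardCSMatrix, coe_standardCSMatrix, csEntryA_cShift h j]
    ext i j
    fin_cases i <;> fin_cases j <;> simp [Matrix.mul_apply, Fin.sum_univ_three] <;> ring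

/-! #### Theorem 3.3 made explicit: `(X_{c,d,n})* ∼ X_{pₙ(c),d,5-n}` -/

/-- `f_{5-n}(pₙ(c)) = fₙ(c) qₙ(c)` (the identity `csPoly_five_sub_comp_kyPoly` evaluated at `c`). [cite: KimYamada2023, Thm. 3.1 (proof)] -/
theorem eval_csPoly_five_sub_kyC (n c : ℤ) :
    (csPoly (5 - n)).eval (c ^ 2 + (1 - n) * c + 1) = (csPoly n).eval c * (kyQuot n).eval c := by
  rw [← eval_kyPoly, ← eval_comp, csPoly_five_sub_comp_kyPoly, eval_mul]

/-- `d ∣ fₙ(c) ⇒ d ∣ f_{5-n}(pₙ(c))`: the dual triple `(pₙ(c), d, 5 - n)` lies in `𝒞𝒮`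
(KY Thm. 3.3: `d* = d`). [cite: KimYamada2023, Thm. 3.3] -/
theorem dvd_eval_csPoly_dual (h : d ∣ (csPoly n).eval c) :
    d ∣ (csPoly (5 - n)).eval (c ^ 2 + (1 - n) * c + 1) := by
  rw [eval_csPoly_five_sub_kyC]
  exact dvd_mul_of_dvd_left h _

/-- The entry `a* = -f_{5-n}(c*)/d` of `X_{c*,d,5-n}` is `a qₙ(c)`. [cite: KimYamada2023, Thm. 3.3] -/
theorem csEntryA_dual (h : d ∣ (csPoly n).eval c) :
    csEntryA (c ^ 2 + (1 - n) * c + 1) d (5 - n) = csEntryA c d n * (kyQuot n).eval c := by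
  apply mul_right_cancel₀ (ne_zero_of_dvd_eval_csPoly h)
  rw [csEntryA_mul (dvd_eval_csPoly_dual h), eval_csPoly_five_sub_kyC, mul_right_comm,
    csEntryA_mul h, neg_mul]

/-- **Theorem 3.3 made explicit: `(X_{c,d,n})*` is conjugate to `X_{pₙ(c),d,5-n}`**, by the
unimodular `U = !![-1, a (c - n + 2), 0; 0, 1, 0; 1, 0, 1]` with `U (X_{c,d,n})* = X_{c*,d,5-n} U`,
`c* = pₙ(c) = c² + (1 - n) c + 1` (entry `a* = a qₙ(c)`). In KY this is
`X_{c,d,n} ↦ X*_{c,d,n} = X_{pₙ(c),d,5-n}` via Prop. 2.14 and Cor. 3.2; `U` is the change of basis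
between the eigenvector bases `((Θ-n+c)(Θ-c), d, Θ-c)` and `((α-5+n+c*)(α-c*), d, α-c*)`,
`α = pₙ(Θ)`, of the one lattice `⟨Θₙ - c, d⟩ = ⟨pₙ(Θₙ) - pₙ(c), d⟩` (Claim in the proof of
Cor. 3.2). [cite: KimYamada2023, Thm. 3.3 and Cor. 3.2] -/
theorem isConj_csDual_standardCSMatrix (h : d ∣ (csPoly n).eval c) :
    IsConj (csDual (standardCSMatrix c d n h))
      (standardCSMatrix (c ^ 2 + (1 - n) * c + 1) d (5 - n) (dvd_eval_csPoly_dual h)) := by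
  have hd := csEntryA_mul h
  have he := eval_csPoly n c
  refine (isConj_iff_exists_isUnit_det _ _).2
    ⟨!![-1, csEntryA c d n * (c - n + 2), 0; 0, 1, 0; 1, 0, 1], ?_, ?_⟩
  · simp [Matrix.det_fin_three]
  · rw [coe_csDual (det_standardCSMatrix_sub_one h), coe_standardCSMatrix, coe_standardCSMatrix,
      csEntryA_dual h, eval_kyQuot, csDualMatrix]
    ext i j
    fin_cases i <;> fin_cases j <;>
      simp [Matrix.mul_apply, Fin.sum_univ_three, Matrix.trace_fin_three, Matrix.one_apply] <;>
      first
        | linear_combination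
        | linear_combination (hd - he)
        | linear_combination (c - n + 2) * (hd - he)
        | linear_combination (c - n + 1) * (hd - he)

end Standard

/-! ### Lemma 3.5: Gompf equivalent matrices have Gompf equivalent duals -/

section Lemma35

/-- **The Δ-move case of KY Lemma 3.5** (parametrised form: `c, d, n` name the middle row and the
trace of `A`). For a Cappell–Shaneson matrix `A` in Gompf's standard form, `A*` and `(Δᵏ A)*` are
Gompf equivalent: with `A ∼ X_{c,d,n}` and `Δᵏ A ∼ X_{c,d,n+kd}` (Remark 2.9),
`A* ∼ X_{c*,d,5-n} ∼_G X_{c*,d,5-n-kd} ∼ X_{c*-kcd,d,5-n-kd} = X_{p_{n+kd}(c),d,5-(n+kd)} ∼ (Δᵏ A)*`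
("`A* = X_{c*,d,5-n}` and `B* = X_{c*,d,5-n-kd}`, and hence `A* ∼_G B*`", with
`p_{n+kd}(c) ≡ pₙ(c) (mod d)` and Remark 2.15). [cite: KimYamada2023, Lemma 3.5] -/
theorem gompfEquiv_csDual_gompfDelta_zpow_mul_of_eq {A : SL(3, ℤ)} (hA : IsGompfStandardForm A)
    (hdet : ((A : Matrix (Fin 3) (Fin 3) ℤ) - 1).det = 1) (k : ℤ) {c d n : ℤ}
    (hc : (A : Matrix (Fin 3) (Fin 3) ℤ) 1 1 = c) (hd : (A : Matrix (Fin 3) (Fin 3) ℤ) 1 2 = d)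
    (hn : Matrix.trace (A : Matrix (Fin 3) (Fin 3) ℤ) = n) :
    GompfEquiv (csDual A) (csDual (gompfDelta ^ k * A)) := by
  -- the Δ-moved matrix `Δᵏ A`: standard form, Cappell–Shaneson, middle row `(0, c, d)`,
  -- trace `n + k d`
  have hB : IsGompfStandardForm (gompfDelta ^ k * A) := hA.gompfDelta_zpow_mul k
  have hBdet : (((gompfDelta ^ k * A : SL(3, ℤ)) : Matrix (Fin 3) (Fin 3) ℤ) - 1).det = 1 := by
    rw [hA.det_gompfDelta_zpow_mul_sub_one]
    exact hdet
  have hBc : ((gompfDelta ^ k * A : SL(3, ℤ)) : Matrix (Fin 3) (Fin 3) ℤ) 1 1 = c := by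
    rw [← hc]
    simp [Matrix.SpecialLinearGroup.coe_mul, coe_gompfDelta_zpow, Matrix.mul_apply,
      Fin.sum_univ_three]
  have hBd : ((gompfDelta ^ k * A : SL(3, ℤ)) : Matrix (Fin 3) (Fin 3) ℤ) 1 2 = d :=
    (gompfDelta_zpow_mul_apply_one_two A k).trans hd
  have hBn : Matrix.trace ((gompfDelta ^ k * A : SL(3, ℤ)) : Matrix (Fin 3) (Fin 3) ℤ) =
      n + k * d := by
    rw [hA.trace_gompfDelta_zpow_mul k, hn, hd]
  -- `A ∼ X := X_{c,d,n}` and `Δᵏ A ∼ X' := X_{c,d,n+kd}` (Remark 2.9)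
  obtain ⟨h₁, hAX⟩ := hA.isConj_standardCSMatrix hdet hc hd hn
  obtain ⟨h₂, hBX'⟩ := hB.isConj_standardCSMatrix hBdet hBc hBd hBn
  -- `X* ∼ X₀ := X_{c*,d,5-n}` and `X'* ∼ X'₀ := X_{p_{n+kd}(c),d,5-(n+kd)}` (Thm. 3.3)
  have hX₀ := isConj_csDual_standardCSMatrix h₁
  have hX'₀ := isConj_csDual_standardCSMatrix h₂
  -- `X₀ ∼_G X₁ := X_{c*,d,5-n-kd}` and `X₁ ∼ X₂ := X_{c*-kcd,d,5-n-kd}` (Remarks 2.17, 2.15)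
  have hX₁ := gompfEquiv_standardCSMatrix_add_mul (dvd_eval_csPoly_dual h₁) (-k)
  have hX₂ := isConj_standardCSMatrix_cShift
    (dvd_eval_csPoly_add_mul (dvd_eval_csPoly_dual h₁) (-k)) (-(k * c))
  -- `X₂ = X'₀`
  have e₄ := GompfEquiv.of_isConj hX₂
  rw [standardCSMatrix_ext _ (dvd_eval_csPoly_dual h₂)
    (show c ^ 2 + (1 - n) * c + 1 + -(k * c) * d = c ^ 2 + (1 - (n + k * d)) * c + 1 by ring)
    (show 5 - n + -k * d = 5 - (n + k * d) by ring)] at e₄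
  exact (GompfEquiv.of_isConj (isConj_csDual hAX)).trans <| (GompfEquiv.of_isConj hX₀).trans <|
    hX₁.trans <| e₄.trans <| (GompfEquiv.of_isConj hX'₀).symm.trans
      (GompfEquiv.of_isConj (isConj_csDual hBX')).symm

/-- **The Δ-move case of KY Lemma 3.5**: for a Cappell–Shaneson matrix `A` in Gompf's standard form
and every `k ∈ ℤ`, the duals `A*` and `(Δᵏ A)*` are Gompf equivalent. [cite: KimYamada2023, Lemma 3.5] -/
theorem gompfEquiv_csDual_gompfDelta_zpow_mul {A : SL(3, ℤ)} (hA : IsGompfStandardForm A)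
    (hdet : ((A : Matrix (Fin 3) (Fin 3) ℤ) - 1).det = 1) (k : ℤ) :
    GompfEquiv (csDual A) (csDual (gompfDelta ^ k * A)) :=
  gompfEquiv_csDual_gompfDelta_zpow_mul_of_eq hA hdet k rfl rfl rfl

/-- **Kim–Yamada 2023, Lemma 3.5 (proved): Gompf equivalent Cappell–Shaneson matrices have Gompf
equivalent duals.** "Suppose that `A` and `B` are two standard matrices such that `A` and `B` are
Gompf equivalent. Then `A*` and `B*` are also Gompf equivalent": induction along the generating
moves — conjugation (`csDual_conj`) and the Δ-move (`gompfEquiv_csDual_gompfDelta_zpow_mul`); the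
Cappell–Shaneson condition propagates along the chain by `GompfEquiv.det_sub_one_eq`.
Rendered as `gompfEquiv_csDual`. [cite: KimYamada2023, Lemma 3.5] -/
theorem gompfEquiv_csDual {A B : SL(3, ℤ)} (h : GompfEquiv A B)
    (hA : ((A : Matrix (Fin 3) (Fin 3) ℤ) - 1).det = 1) : GompfEquiv (csDual A) (csDual B) := by
  induction h with
  | rel A B hAB =>
    rcases hAB with hc | ⟨hstd, hdet, k, rfl⟩
    · exact GompfEquiv.of_isConj (isConj_csDual hc)
    · exact gompfEquiv_csDual_gompfDelta_zpow_mul hstd hdet k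
  | refl A => exact GompfEquiv.refl _
  | symm A B h ih =>
    refine (ih ?_).symm
    rw [← GompfEquiv.det_sub_one_eq h]
    exact hA
  | trans A B C h₁ _ ih₁ ih₂ =>
    refine (ih₁ hA).trans (ih₂ ?_)
    rw [GompfEquiv.det_sub_one_eq h₁]
    exact hA

end Lemma35

/-! ### Theorem A -/

section TheoremA

/-- The dual of the Akbulut–Kirby matrix: `A₀* = A₀² - A₀ + 1 = !![1, 0, 1; 1, 1, 1; 0, 1, 1]`
(trace `3`; KY Example 3.4 / proof of Thm. A: "`A₀*` is similar to `A₁`"). [cite: KimYamada2023, Thm. A (proof, §3)] -/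
theorem coe_csDual_akbulutKirbyMatrix :
    ((csDual akbulutKirbyMatrix : SL(3, ℤ)) : Matrix (Fin 3) (Fin 3) ℤ) = !![1, 0, 1; 1, 1, 1; 0, 1, 1] := by
  rw [coe_csDual det_akbulutKirbyMatrix_sub_one, coe_akbulutKirbyMatrix, csDualMatrix]
  decide

/-- **`A₀*` is conjugate to `A₁ = X_{1,1,3}`** (KY, proof of Thm. A: "`A₀*` is similar to `A₁`"),
by the explicit `P = !![0, -1, 1; -1, 0, 0; 0, 0, -1]`, `P A₀* = A₁ P`. [cite: KimYamada2023, Thm. A (proof, §3)] -/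
theorem isConj_csDual_akbulutKirbyMatrix :
    IsConj (csDual akbulutKirbyMatrix) (cappellShanesonMatrix 1) := by
  refine (isConj_iff_exists_isUnit_det _ _).2 ⟨!![0, -1, 1; -1, 0, 0; 0, 0, -1], ?_, ?_⟩
  · simp [Matrix.det_fin_three]
  · rw [coe_csDual_akbulutKirbyMatrix, coe_cappellShanesonMatrix]
    decide

/-- **`A₀* ∼ A₀`**: `A₀* ∼ A₁ ∼ A₀` (Remark 2.22 / Gompf's Examples 3.1(a) for `A₁`). [cite: KimYamada2023, Thm. A (proof, §3)] -/
theorem gompfEquiv_csDual_akbulutKirbyMatrix : GompfEquiv (csDual akbulutKirbyMatrix) akbulutKirbyMatrix :=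
  (GompfEquiv.of_isConj isConj_csDual_akbulutKirbyMatrix).trans
    (gompfEquiv_cappellShanesonMatrix_akbulutKirbyMatrix 1)

/-- **Kim–Yamada 2023, Theorem A (one direction, proved): if Gompf's conjecture is true for trace
`n` then it is true for trace `5 - n`.** Printed proof (§3, end): for `X` of trace `5 - n`, `X*` has
trace `n`, so `X* ∼ A₀`; then `X ∼ (X*)* ∼ A₀* ∼ A₁ ∼ A₀` by Lemmas 3.6, 3.5 and Example 3.4. Here:
`csDual_csDual`, `gompfEquiv_csDual`, `gompfEquiv_csDual_akbulutKirbyMatrix`; the reduction to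
standard matrices ("every matrix is similar to a standard matrix", Thm. 2.6) is not needed since
the dual is defined for every Cappell–Shaneson matrix. [cite: KimYamada2023, Thm. A] -/
theorem gompfConjectureForTrace_of_five_sub {n : ℤ} (hn : GompfConjectureForTrace n) :
    GompfConjectureForTrace (5 - n) := by
  intro A hdet htr
  have h₁ : GompfEquiv (csDual A) akbulutKirbyMatrix :=
    hn (csDual A) (det_coe_csDual_sub_one hdet) (by rw [trace_coe_csDual hdet, htr]; ring)
  have h₂ := gompfEquiv_csDual h₁ (det_coe_csDual_sub_one hdet)
  rw [csDual_csDual hdet] at h₂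
  exact h₂.trans gompfEquiv_csDual_akbulutKirbyMatrix

/-- **Kim–Yamada 2023, Theorem A (proved)**: "Conjecture 2 is true for trace `n` if and only if
Conjecture 2 is true for trace `5 - n` for any integer `n`" — in the tree's rendering
`GompfConjectureForTrace` (every `A ∈ SL(3, ℤ)` with `det (A - 1) = 1` and trace `n` is Gompf
equivalent to `A₀`). [cite: KimYamada2023, Thm. A] -/
theorem gompfConjectureForTrace_iff_five_sub (n : ℤ) :
    GompfConjectureForTrace n ↔ GompfConjectureForTrace (5 - n) :=
  ⟨gompfConjectureForTrace_of_five_sub, fun h => by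
    simpa using gompfConjectureForTrace_of_five_sub h⟩

/-- **Example 3.4 / Table 1 transferred: Gompf's conjecture for trace `10` from the two classes at
trace `-5`** ("there are only two similarity classes of matrices with trace `10`, which are
represented by `A*`, `B*`"): conditional, like `gompfConjectureForTrace_neg_five_of`, on the
Aitchison–Rubinstein two-class fact `aitchisonRubinstein1984_traceNegFiveClasses`. [cite: KimYamada2023, Example 3.4] -/
theorem gompfConjectureForTrace_ten_of (hAR5 : aitchisonRubinstein1984_traceNegFiveClasses) :
    GompfConjectureForTrace 10 := by
  simpa using gompfConjectureForTrace_of_five_sub (gompfConjectureForTrace_neg_five_of hAR5)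

end TheoremA

/-! ### Consequences for Theorem B and the named fact -/

section TheoremB

/-- **"By Theorem A, it suffices to check that Conjecture 2 is true for trace `n` where
`3 ≤ n ≤ 69`"** (KY §6.1, proof of Thm. B): Theorem B on `[3, 69]` implies Theorem B on the whole
range `[-64, 69]`, since `n ≤ 2` and `-64 ≤ n` give `3 ≤ 5 - n ≤ 69`. [cite: KimYamada2023, §6.1 (proof of Thm. B)] -/
theorem forall_gompfConjectureForTrace_of_Icc_three
    (hB : ∀ n ∈ Icc (3 : ℤ) 69, GompfConjectureForTrace n) :
    ∀ n ∈ Icc (-64 : ℤ) 69, GompfConjectureForTrace n := by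
  intro n hn
  simp only [mem_Icc] at hn
  by_cases h3 : 3 ≤ n
  · exact hB n (by simp only [mem_Icc]; omega)
  · have h := gompfConjectureForTrace_of_five_sub (hB (5 - n) (by simp only [mem_Icc]; omega))
    rwa [sub_sub_cancel] at h

/-- **The matrix form of KY Lemma 6.1 (the induction step of the proof of Thm. B).** Suppose
Gompf's conjecture is true for every trace `3 ≤ m ≤ n - 1` (KY assume `n > 3`; the hypothesis is
not needed for the implication). If every Cappell–Shaneson
matrix of trace `n` is conjugate to a standard matrix `X_{c,d,n}` with `n ≡ n₀ (mod d)` for some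
`6 - n ≤ n₀ ≤ n - 1` ("every element of `C(ℤ[Θₙ])` has a representative `(c, d, n)` such that
`n ≡ n₀ (mod d)`" — the ideal-class input, hypothesis `hrep`), then Gompf's conjecture is true for
trace `n`: `X_{c,d,n} ∼_G X_{c,d,n₀}` (`gompfEquiv_standardCSMatrix_add_mul`) and trace `n₀` is settled,
directly if `n₀ ≥ 3` and through Theorem A (`4 ≤ 5 - n₀ ≤ n - 1`) if `n₀ ≤ 2`. [cite: KimYamada2023, Lemma 6.1] -/
theorem gompfConjectureForTrace_of_representatives {n : ℤ}
    (hind : ∀ m ∈ Icc (3 : ℤ) (n - 1), GompfConjectureForTrace m)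
    (hrep : ∀ A : SL(3, ℤ), ((A : Matrix (Fin 3) (Fin 3) ℤ) - 1).det = 1 →
      Matrix.trace (A : Matrix (Fin 3) (Fin 3) ℤ) = n →
      ∃ (c d k n₀ : ℤ) (h : d ∣ (csPoly n).eval c),
        n₀ ∈ Icc (6 - n) (n - 1) ∧ n = n₀ + k * d ∧ IsConj A (standardCSMatrix c d n h)) :
    GompfConjectureForTrace n := by
  intro A hdet htr
  obtain ⟨c, d, k, n₀, h, hn₀, hnk, hconj⟩ := hrep A hdet htr
  have hG := gompfEquiv_standardCSMatrix_add_mul h (-k)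
  have hn₀' : n + -k * d = n₀ := by linear_combination hnk
  have hX : GompfEquiv (standardCSMatrix c d (n + -k * d) (dvd_eval_csPoly_add_mul h (-k)))
      akbulutKirbyMatrix := by
    simp only [mem_Icc] at hn₀
    by_cases h3 : 3 ≤ n₀
    · exact hind n₀ (by simp only [mem_Icc]; omega) _ (det_standardCSMatrix_sub_one _)
        (by rw [trace_standardCSMatrix, hn₀'])
    · have h5 := gompfConjectureForTrace_of_five_sub
        (hind (5 - n₀) (by simp only [mem_Icc]; omega))
      rw [sub_sub_cancel] at h5
      exact h5 _ (det_standardCSMatrix_sub_one _) (by rw [trace_standardCSMatrix, hn₀'])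
  exact ((GompfEquiv.of_isConj hconj).trans hG).trans hX

/-- **The named fact from Theorem B on `[3, 69]` and the leaves.** Kim–Yamada's Cor. C
(`kimYamada2023_nonempty_diffeomorph_sphere_four_of_trace_mem_Icc`) follows from Gompf's three
topological leaves (`gompf2010_deltaMove`, `gompf2010_akbulutKirby_framings`,
`akbulutKirby1979_sphere_four`) and Gompf's conjecture for the traces `3 ≤ n ≤ 69` only — the part of
Theorem B that KY actually compute (§6.1, Tables 2–6) — Theorem A supplying the traces
`-64 ≤ n ≤ 2` (`forall_gompfConjectureForTrace_of_Icc_three` and the tree's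
`kimYamada2023_nonempty_diffeomorph_sphere_four_of_trace_mem_Icc_of`). [cite: KimYamada2023, Thm. B and Cor. C (§1.2, §6.1)] -/
theorem kimYamada2023_nonempty_diffeomorph_sphere_four_of_trace_mem_Icc_of_Icc_three
    (hΔ : gompf2010_deltaMove.{u}) (h43 : gompf2010_akbulutKirby_framings.{0, 0})
    (hAK : akbulutKirby1979_sphere_four) (hB : ∀ n ∈ Icc (3 : ℤ) 69, GompfConjectureForTrace n) :
    kimYamada2023_nonempty_diffeomorph_sphere_four_of_trace_mem_Icc.{u} :=
  kimYamada2023_nonempty_diffeomorph_sphere_four_of_trace_mem_Icc_of hΔ h43 hAK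
    (forall_gompfConjectureForTrace_of_Icc_three hB)

end TheoremB

end Literature.Topology.FourManifolds

end
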